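import Summits.ResolutionOfSingularities.ResolutionOfSingularities.Theorems.FrobeniusClosingPatchingRelPerfectMonomialRouteKBlowupCharts
import Summits.ResolutionOfSingularities.ResolutionOfSingularities.Theorems.FrobeniusClosingPatchingRelPerfectMonomialRouteKSubstAlgebra
import HarnessLib

/-!
# Crux `PatchingRelPerfect` (stmt-ResolutionOfSingularities-16161), chain w52 — TargetsF3 (m)
# «M2-strong», COMBINATORIAL HALF, Route K step K12b: TRANSFORMS READ IN THE NEW CHARTS — the
# exceptional divisor, the strict transforms of the boundary and the controlled transform of the
# monomial ideal, in a chart of the blow-up of a toric chart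

[OURS · L1 W5.2 · design memo v3 (`L/res-type-075/M2STRONG-COMBINATORIAL-HALF.md`); fact-free;
nothing here is a statement of the manuscript under review]

For a chart `c' = Chart.ofMap lab g` of `Y'` lying over a toric chart `c` of `Y` with
`g ≫ π = Spec (ρ ∘ e) ≫ (Spec Γ(Y,U) → Y)` (file K11), every ideal sheaf built from pull-backs by colons
and unions is read in `c'` by the same operations on `ρ(e(·))` (`img_colon`, `img_iSup`,
`img_ofMap_strictTransform`, `img_ofMap_controlledTransform`).  With `ρ = subst_j` and `C` read as
`(x_S)` (file K12a) this gives, in the `j`-chart: exceptional divisor `(x_j)` (`img_new_exc`), strict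
transform of `V(x_b)` = `V(x_b)` for `b ≠ j` and `∅` for `b = j` (`img_new_strict_of_img_eq_span_X`),
a stratum `V(x_S)` pulls back to `(x_j)` and a divisor missing `U` to `⊤`, and the controlled transform
(marking `m`) of the monomial ideal is the ideal of the MOVED monomials (`img_new_controlled`); in a
LIFTED chart (`ρ = id`, `C` missing `U`) nothing changes (`img_lift_*`).
-/

-- `Summit.<Summit>.<Sub>.Theorems` with `Sub = Summit` (single-conjunct summit, D-0017)
set_option linter.dupNamespace false

noncomputable section

open CategoryTheory AlgebraicGeometry TopologicalSpace MvPolynomial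
open Literature.AlgebraicGeometry.Resolution

namespace Summit.ResolutionOfSingularities.ResolutionOfSingularities.Theorems

namespace PolyhedraGame

namespace RouteK

variable {L : Finset ℕ}

/-! ## Colons and unions read in a chart -/

/-- [OURS] A ring isomorphism carries colon ideals to colon ideals. -/
theorem Ideal.map_colon_of_equiv {A B : Type*} [CommRing A] [CommRing B] (e : A ≃+* B) (I J : Ideal A) :
    (I.colon (J : Set A)).map (e : A →+* B) = (I.map (e : A →+* B)).colon (J.map (e : A →+* B) : Set B) := by
  ext x
  rw [Ideal.map_comap_of_equiv, Ideal.mem_comap, Submodule.mem_colon, Submodule.mem_colon]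
  constructor
  · intro h t ht
    rw [SetLike.mem_coe, Ideal.map_comap_of_equiv, Ideal.mem_comap] at ht
    have := h _ ht
    rw [smul_eq_mul, Ideal.map_comap_of_equiv, Ideal.mem_comap]
    rw [smul_eq_mul] at this
    change e.symm (x * t) ∈ I
    rw [map_mul]
    exact this
  · intro h s hs
    have := h (e s) (by
      rw [SetLike.mem_coe, Ideal.map_comap_of_equiv, Ideal.mem_comap]
      change e.symm (e s) ∈ J
      rw [e.symm_apply_apply]; exact hs)
    rw [smul_eq_mul, Ideal.map_comap_of_equiv, Ideal.mem_comap] at this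
    change e.symm (x * e s) ∈ I at this
    rw [map_mul, e.symm_apply_apply] at this
    rw [smul_eq_mul]
    exact this

namespace Chart

variable {Y : Scheme.{0}} (c : Chart L Y)

/-- [OURS] **Colon ideal sheaves read in a chart** (locally Noetherian level). -/
theorem img_colon [IsLocallyNoetherian Y] (A B : Y.IdealSheafData) :
    c.img (colon A B) = (c.img A).colon (c.img B : Set (MvPolynomial L ℚ)) := by
  unfold Chart.img
  rw [ideal_colon, Ideal.map_colon_of_equiv]

/-- [OURS] Unions of ideal sheaves read in a chart. -/
theorem img_iSup {ι : Type*} (J : ι → Y.IdealSheafData) : c.img (⨆ i, J i) = ⨆ i, c.img (J i) := by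
  unfold Chart.img
  have h := congrFun (Scheme.IdealSheafData.ideal_iSup (I := J)) c.U
  rw [iSup_apply] at h
  rw [h, Ideal.map_iSup]

end Chart

/-! ## Transforms read in a chart of the blow-up -/

section OfMap

variable {Y Y' : Scheme.{0}} [IsLocallyNoetherian Y'] {π : Y' ⟶ Y} {C : Y.IdealSheafData} (c : Chart L Y)
  (lab : ℕ → ℕ) (g : Spec (Rc L) ⟶ Y') [IsOpenImmersion g] (ρ : MvPolynomial L ℚ →+* MvPolynomial L ℚ)
  (hg : g ≫ π = Spec.map (CommRingCat.ofHom (ρ.comp (c.e : Γ(Y, c.U) →+* MvPolynomial L ℚ))) ≫ c.U.2.fromSpec)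
include hg

/-- [OURS · Route K] **The strict transform read in the new chart**: `⋃ₙ (ρ e K(U) : (ρ e C(U))ⁿ)`. -/
theorem img_ofMap_strictTransform (K : Y.IdealSheafData) :
    (Chart.ofMap lab g).img (strictTransformIdeal π C K) =
      ⨆ n : ℕ, ((c.img K).map ρ).colon (↑(((c.img C).map ρ) ^ n) : Set (MvPolynomial L ℚ)) := by
  rw [strictTransformIdeal, Chart.img_iSup]
  refine iSup_congr fun n => ?_
  rw [Chart.img_colon, Chart.img_pow, Chart.img_ofMap_comap c lab g ρ hg, Chart.img_ofMap_comap c lab g ρ hg]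

/-- [OURS · Route K] **The controlled transform read in the new chart**: `(ρ e I(U) : (ρ e C(U))^μ)`. -/
theorem img_ofMap_controlledTransform (I : Y.IdealSheafData) (μ : ℕ) :
    (Chart.ofMap lab g).img (controlledTransform π C I μ) =
      ((c.img I).map ρ).colon (↑(((c.img C).map ρ) ^ μ) : Set (MvPolynomial L ℚ)) := by
  rw [controlledTransform, Chart.img_colon, Chart.img_pow, Chart.img_ofMap_comap c lab g ρ hg,
    Chart.img_ofMap_comap c lab g ρ hg]

end OfMap

/-! ## The `j`-chart of the blow-up along `(x_S)` -/

section New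

/-- [OURS] The centre read through the substitution: `(x_j)`. -/
theorem map_subst_img_centre {Y : Scheme.{0}} {C : Y.IdealSheafData} (c : Chart L Y) {S : Finset L}
    (hS : c.img C = coordIdeal S) {j : L} (hj : j ∈ S) :
    (c.img C).map (coordBlowupSubst ℚ (S : Set L) j).toRingHom = Ideal.span {(MvPolynomial.X j : MvPolynomial L ℚ)} := by
  rw [hS]
  exact map_coordBlowupSubst_span_eq ℚ (S : Set L) j (Finset.mem_coe.mpr hj)

variable {Y Y' : Scheme.{0}} [IsLocallyNoetherian Y'] {π : Y' ⟶ Y} {C : Y.IdealSheafData} (c : Chart L Y)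
  {S : Finset L} (hS : c.img C = coordIdeal S) {j : L} (hj : j ∈ S)
  (lab : ℕ → ℕ) (g : Spec (Rc L) ⟶ Y') [IsOpenImmersion g]
  (hg : g ≫ π = Spec.map (CommRingCat.ofHom ((coordBlowupSubst ℚ (S : Set L) j).toRingHom.comp
    (c.e : Γ(Y, c.U) →+* MvPolynomial L ℚ))) ≫ c.U.2.fromSpec)
include hS hj hg

omit [IsLocallyNoetherian Y'] in
/-- [OURS · Route K] **The exceptional divisor is `V(x_j)` in the `j`-chart.** -/
theorem img_new_exc : (Chart.ofMap lab g).img (C.comap π) = Ideal.span {(MvPolynomial.X j : MvPolynomial L ℚ)} := by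
  rw [Chart.img_ofMap_comap c lab g _ hg, map_subst_img_centre c hS hj]

/-- [OURS · Route K] **Strict transforms of the boundary in the `j`-chart**: a divisor read as `(x_b)` in
`c` has strict transform read as `(x_b)` if `b ≠ j`, and as `⊤` (empty) if `b = j`. -/
theorem img_new_strict_of_img_eq_span_X [DecidableEq L] {K : Y.IdealSheafData} {b : L}
    (hK : c.img K = Ideal.span {(MvPolynomial.X b : MvPolynomial L ℚ)}) :
    (Chart.ofMap lab g).img (strictTransformIdeal π C K) =
      if b = j then ⊤ else Ideal.span {(MvPolynomial.X b : MvPolynomial L ℚ)} := by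
  rw [img_ofMap_strictTransform c lab g _ hg, map_subst_img_centre c hS hj, hK, Ideal.map_span,
    Set.image_singleton]
  simp_rw [Ideal.span_singleton_pow]
  by_cases hbj : b = j
  · subst hbj
    rw [if_pos rfl, AlgHom.toRingHom_eq_coe, AlgHom.coe_toRingHom, coordBlowupSubst_X_self]
    exact iSup_colon_span_X_self b
  · rw [if_neg hbj, AlgHom.toRingHom_eq_coe, AlgHom.coe_toRingHom]
    by_cases hbS : b ∈ S
    · rw [coordBlowupSubst_X_of_mem_of_ne ℚ (S : Set L) j (Finset.mem_coe.mpr hbS) hbj]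
      exact iSup_colon_span_X_mul_X b j hbj
    · rw [coordBlowupSubst_X_of_not_mem ℚ (S : Set L) j (fun h => hbS (Finset.mem_coe.mp h))]
      exact iSup_colon_span_X b j hbj

omit hS hj in
/-- [OURS · Route K] A divisor missing `U` has strict transform missing the `j`-chart. -/
theorem img_new_strict_of_img_eq_top {K : Y.IdealSheafData} (hK : c.img K = ⊤) :
    (Chart.ofMap lab g).img (strictTransformIdeal π C K) = ⊤ := by
  rw [img_ofMap_strictTransform c lab g _ hg, hK, Ideal.map_top]
  exact top_le_iff.mp (le_iSup_of_le 0 Ideal.le_colon)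

omit [IsLocallyNoetherian Y'] in
/-- [OURS · Route K] **A pulled-back ideal sheaf read as `(x_S)` in `c` is read as `(x_j)` in the
`j`-chart** (the exceptional divisor over the component of the centre seen by `c`), and one read as `⊤`
stays `⊤`. -/
theorem img_new_comap_of_img_eq_coordIdeal {K : Y.IdealSheafData} (hK : c.img K = coordIdeal S) :
    (Chart.ofMap lab g).img (K.comap π) = Ideal.span {(MvPolynomial.X j : MvPolynomial L ℚ)} := by
  rw [Chart.img_ofMap_comap c lab g _ hg, hK, ← hS, map_subst_img_centre c hS hj]

omit [IsLocallyNoetherian Y'] hS hj in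
/-- [OURS · Route K] A pulled-back ideal sheaf read as `⊤` in `c` is read as `⊤` in the `j`-chart. -/
theorem img_new_comap_of_img_eq_top {K : Y.IdealSheafData} (hK : c.img K = ⊤) :
    (Chart.ofMap lab g).img (K.comap π) = ⊤ := by
  rw [Chart.img_ofMap_comap c lab g _ hg, hK, Ideal.map_top]

/-- [OURS · Route K] **The controlled transform (marking `m`) of the monomial ideal in the `j`-chart is the
ideal of the moved monomials** (file K12a `colon_map_subst_span_monomial`), provided every member has
`S`-degree `≥ m` (the centre is permissible). -/
theorem img_new_controlled {I : Y.IdealSheafData} {A : Finset (ℕ →₀ ℕ)} (hI : c.img I = c.monIdeal A) (m : ℕ)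
    (hA : ∀ α ∈ A, m ≤ sdeg S (c.expOf α)) :
    (Chart.ofMap lab g).img (controlledTransform π C I m) =
      Ideal.span ((fun α => monomial (c.expOf α + Finsupp.single j (sdeg (S.erase j) (c.expOf α)) -
        Finsupp.single j m) (1 : ℚ)) '' (A : Set (ℕ →₀ ℕ))) := by
  classical
  rw [img_ofMap_controlledTransform c lab g _ hg, map_subst_img_centre c hS hj, hI, Chart.monIdeal_eq,
    Ideal.span_singleton_pow, AlgHom.toRingHom_eq_coe]
  rw [show Ideal.map ((coordBlowupSubst ℚ (S : Set L) j : MvPolynomial L ℚ →+* MvPolynomial L ℚ))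
      (Ideal.span ((fun β => monomial β (1 : ℚ)) '' (c.expOf '' (A : Set (ℕ →₀ ℕ))))) =
      Ideal.map (coordBlowupSubst ℚ (S : Set L) j) (Ideal.span ((fun β => monomial β (1 : ℚ)) '' (c.expOf '' (A : Set (ℕ →₀ ℕ)))))
      from rfl,
    colon_map_subst_span_monomial S hj _ m (by
      rintro _ ⟨α, hα, rfl⟩; exact hA α hα),
    Set.image_image]

end New

/-! ## A lifted chart (the centre misses `U`) -/

section Lift

variable {Y Y' : Scheme.{0}} [IsLocallyNoetherian Y'] {π : Y' ⟶ Y} {C : Y.IdealSheafData} (c : Chart L Y)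
  (htop : c.img C = ⊤) (lab : ℕ → ℕ) (g : Spec (Rc L) ⟶ Y') [IsOpenImmersion g]
  (hg : g ≫ π = Spec.map (CommRingCat.ofHom ((RingHom.id _).comp (c.e : Γ(Y, c.U) →+* MvPolynomial L ℚ))) ≫
    c.U.2.fromSpec)
include htop hg

omit [IsLocallyNoetherian Y'] htop in
/-- [OURS · Route K] In a lifted chart a pulled-back ideal sheaf reads as before. -/
theorem img_lift_comap (K : Y.IdealSheafData) : (Chart.ofMap lab g).img (K.comap π) = c.img K := by
  rw [Chart.img_ofMap_comap c lab g _ hg, Ideal.map_id]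

/-- [OURS · Route K] In a lifted chart the strict transform reads as the divisor did. -/
theorem img_lift_strict (K : Y.IdealSheafData) :
    (Chart.ofMap lab g).img (strictTransformIdeal π C K) = c.img K := by
  rw [img_ofMap_strictTransform c lab g _ hg, htop, Ideal.map_top, Ideal.map_id]
  exact iSup_colon_top _

/-- [OURS · Route K] In a lifted chart the controlled transform reads as the ideal did. -/
theorem img_lift_controlled (I : Y.IdealSheafData) (μ : ℕ) :
    (Chart.ofMap lab g).img (controlledTransform π C I μ) = c.img I := by
  rw [img_ofMap_controlledTransform c lab g _ hg, htop, Ideal.map_top, Ideal.map_id]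
  exact colon_top_pow _ _

end Lift

end RouteK

end PolyhedraGame

end Summit.ResolutionOfSingularities.ResolutionOfSingularities.Theorems

end
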